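import Summits.CriticalPhenomena.CardyFormulaZ2.Theorems.CardyMagicRigidityNestingRigidityHoelderReduction
import Summits.CriticalPhenomena.CardyFormulaZ2.Theorems.CardyMagicRigidityNestingRigidityTowerMomentLower
import Summits.CriticalPhenomena.CardyFormulaZ2.Theorems.CardyMagicRigidityNestingRigidityTowerMomentUpper
import Summits.CriticalPhenomena.CardyFormulaZ2.Theorems.CardyMagicRigidityNestingRigidityUVExpMomentsChargeFree
import Summits.CriticalPhenomena.CardyFormulaZ2.Theorems.CardyMagicRigidityNestingRigidityUVFarBite
import Summits.CriticalPhenomena.CardyFormulaZ2.Theorems.CardyMagicRigidityNestingRigidityUVFarBiteSq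
import Summits.CriticalPhenomena.CardyFormulaZ2.Theorems.CardyMagicRigidityNestingRigidityUVCollar
import HarnessLib

/-!
# Crux `NestingRigidity`: stub R1' `stub_uvDecoupling` CLOSED on both lattices (the untilted route)

Crux `Summit.CriticalPhenomena.CardyFormulaZ2.Theses.CardyMagicRigidity.NestingRigidity` (stmt-CriticalPhenomena-4835).
Shared registered stub R1' of lines `ring-cloud-tomography` (r6, seat c3-0) and `positive-cone-weight-doubling` (r4, seat
c4-0): `stub_uvDecoupling : ∀ E ∈ latticeEnsembles, UVDecoupling E` — for both critical lattice ensembles (bond-`ℤ²`, site-`𝕋`)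
the nesting transform of the cone cloud equals the tilted tower moment `E_δ[w(t)^{N_0(r,1)}]` times the UV drift
`exp(√3 t E_δ N_0(r,1))` of the SAME ensemble up to `r^{±η}`, for all small `r` and then all small meshes.  Composition of landed
helpers only (no cited fact, no definition):
* [C] `uvDecoupling_of_untilted_bounds` (…HoelderReduction p128475, …HoelderToolkit p128310): Hölder / reverse Hölder in the tower
  weight with exponent `1 + ε` and interpolation of tower moments in the base reduce `UVDecoupling E` to untilted all-order
  exponential moments [A] and a-priori tower-moment power bounds [B];
* [B] `towerMoment_lower_latticeEnsembles` (…TowerMomentLower p128174: Jensen + keystone K1) and `towerMoment_upper_latticeEnsembles`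
  (…TowerMomentUpper p129280: thin dyadic cells + one global BK/Reimer product);
* [A] `uvExpMoments_of_chargeFree_bounds` (…UVExpMomentsChargeFree p129762 over …Reduction/Cell/Assembly/Indep/Dilation) from the three
  charge-free inputs Ξ `uvFarBite_expMoment_latticeEnsembles` (…UVFarBite p132797: the multi-scale disc/ring interior statistic,
  chessboard independence, keystone K6), Ξ₂ `uvFarBiteSq_expMoment_latticeEnsembles` (…UVFarBiteSq p132341), K
  `uvCollar_expMoment_latticeEnsembles` (…UVCollar p132406: exit loops and collar crossers).
Consequences recorded: `coneTiltLaw_of_cloudLaw_latticeEnsembles` — every lattice ensemble with the cloud law satisfies the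
self-consistent cone law — and `coneScaling : ConeScaling` (`MagicFormulaZ2 → ConeTiltLaw zEns`, STUB 1 of line
`positive-cone-weight-doubling`, via `cloudLaw_zEns_of` p107226).
-/

noncomputable section

open MeasureTheory Set Filter Metric
open scoped Real Topology BigOperators

namespace Summit.CriticalPhenomena.CardyFormulaZ2.Cruxes.NestingRigidity.PositiveConeWeightDoubling

open Summit.CriticalPhenomena.CardyFormulaZ2.Cruxes.NestingRigidity.RingCloudTomography
open Summit.CriticalPhenomena.CardyFormulaZ2.Theses.CardyMagicRigidity

/-- **R1' closed · UV decoupling on both lattice ensembles** (registered shared stub `stub_uvDecoupling`). -/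
theorem stub_uvDecoupling : ∀ E ∈ latticeEnsembles, UVDecoupling E := fun E hE ↦
  uvDecoupling_of_untilted_bounds E hE
    (uvExpMoments_of_chargeFree_bounds E hE (uvFarBite_expMoment_latticeEnsembles E hE)
      (uvFarBiteSq_expMoment_latticeEnsembles E hE) (uvCollar_expMoment_latticeEnsembles E hE))
    (towerMoment_lower_latticeEnsembles E hE) (towerMoment_upper_latticeEnsembles E hE)

/-- **The self-consistent cone law of every lattice ensemble with the cloud law**: for `E ∈ latticeEnsembles`,
`E.CloudLaw → ConeTiltLaw E` (`coneTiltLaw_of_cloudLaw`, p107226, fed with `stub_uvDecoupling`). -/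
theorem coneTiltLaw_of_cloudLaw_latticeEnsembles : ∀ E ∈ latticeEnsembles, E.CloudLaw → ConeTiltLaw E :=
  fun E hE hc ↦ coneTiltLaw_of_cloudLaw hc (stub_uvDecoupling E hE)

/-- **STUB 1 of line `positive-cone-weight-doubling` · `ConeScaling`**: `MagicFormulaZ2 → ConeTiltLaw zEns` — the magic formula of
bond-`ℤ²` forces the tilted tower moments of bond-`ℤ²`, renormalised by their own UV drift, to have EXACTLY the Gaussian exponent
`βt²` in the positive cone `|t| < π/6`. -/
theorem coneScaling : ConeScaling := fun hZ ↦
  coneTiltLaw_of_cloudLaw (cloudLaw_zEns_of hZ) (stub_uvDecoupling zEns zEns_mem)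

end Summit.CriticalPhenomena.CardyFormulaZ2.Cruxes.NestingRigidity.PositiveConeWeightDoubling

end
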